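import Summits.CriticalPhenomena.CardyFormulaZ2.Theorems.CardyComplexConeEdgePrecompactUFRSArmDominationFace
import Summits.CriticalPhenomena.CardyFormulaZ2.Theorems.CardyComplexConeEdgePrecompactUFRSArmDominationFreeTail

/-!
# Arm domination, SPLIT case: assembly from the last departure
(line `qkz-strip-boundary-arm` of crux `CardyComplexCone.EdgePrecompact`, stmt-CriticalPhenomena-11387;
deterministic assembly of the corrected item (H₁) `ufrs_armDomination2` of the road map for the
uniform forward response stability "UFRS", SPLIT branch of `ufrs_failureStructure`)

`ufrs_lastDeparture` (`…UFRSLastDeparture.lean`) splits the SPLIT branch by the position of the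
LAST CONTACT `O₁ e j = O₀ a i` of the second run with the first stretch:
* `j < T`: nonempty free tail — `ufrs_freeTailCase_cert_of` (`…ArmDominationFreeTail.lean`),
  complete up to the registered residual `ufrs_doublyMarkedCase_cert`;
* `j = T`, the run enters the ball at the re-entry corner `O₀ a n` itself (a slipped return with
  a turning mismatch, case (B) of the road map): the registered residual
  `ufrs_slippedReturnCase_cert` — its certificate is the enclosure statement "a mismatch forces
  the bigon to surround the ball" (Hopf's Umlaufsatz for the cusp-free bigon, hole-freeness of
  the inner faces), not available in the tree;
* `j = T`, the run leaves the inner faces of the translate: the contact IS the exit corner of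
  the translate, on the stretch — `ufrs_exitCornerOnStretch_cert` (`…ArmDominationFace.lean`).
`ufrs_splitCase_cert_of` records this: the two residual sub-goals imply the certificate for the
whole SPLIT branch.

References: S. Smirnov, C. R. Acad. Sci. Paris 333 (2001), §2; H. Hopf, Compositio Math. 2
(1935); P. Nolin, Electron. J. Probab. 13 (2008), §4.
-/

namespace Summit.CriticalPhenomena.CardyFormulaZ2.Cruxes.EdgePrecompact.QkzStripBoundaryArm

open MeasureTheory Filter Set Metric
open scoped Topology BigOperators Pointwise
open Literature.Probability.LatticeModels Literature.Probability.Percolation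
open Literature.Probability.RandomPlanarGeometry (DobrushinDomain)
open Summit.CriticalPhenomena.CardyFormulaZ2.Theses.CardyComplexCone

noncomputable section

/-- **The SPLIT branch certifies, up to the two residual configurations** (registered
conditional sub-goal `ufrs_splitCase_cert_of` of stmt-CriticalPhenomena-11387; SPLIT branch of the
corrected arm domination `ufrs_armDomination2`). HYPOTHESES (as the named propositions
`ufrsResidualSlippedReturn`, `ufrsResidualDoublyMarked`): the registered residual sub-goals
`ufrs_slippedReturnCase_cert` (the second run ends AT the re-entry corner `O₀ a n` of the first
stretch with a turning mismatch — case (B) of the road map, whose certificate needs the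
enclosure argument "a mismatch forces the bigon to surround the ball") and
`ufrs_doublyMarkedCase_cert` (see `ufrs_freeTailCase_cert_of`). DATA: the SPLIT branch of
`ufrs_failureStructure`. CONCLUSION: `ω` is certified at a collar point. Proof: by
`ufrs_lastDeparture`, either the free tail after the last contact is nonempty
(`ufrs_freeTailCase_cert_of`), or the run ends on the stretch — entering the ball at the
re-entry corner (first hypothesis), or leaving the inner faces of the translate at its exit
corner, which then lies on the stretch (`ufrs_exitCornerOnStretch_cert`). -/
theorem ufrs_splitCase_cert_of : ufrsResidualSlippedReturn → ufrsResidualDoublyMarked → ∀ (D : DobrushinDomain) (η : ℝ), 0 < η → ∃ δ₀ > (0:ℝ), ∀ E : DiscreteDobrushin, E.Ω = D.carrier → E.IsZdAdmissible → E.δ < δ₀ → ∀ (v w : Site 2) (ρ : ℝ), 4 * η ≤ ρ → 2 * ρ ≤ infDist (meshPoint E.δ v) D.carrierᶜ → ‖meshPoint E.δ w‖ < η → ∀ (ω : BondConfig (Site 2)) (a a' : Site 2 × Fin 4) (n m k T : ℕ), ((E.IsStartCorner a ∧ (shiftData E w).IsStartCorner a') ∨ (a = a' ∧ medialPoint E.δ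 (cSrc a) ∈ ball (meshPoint E.δ v) ρ ∧ medialPoint E.δ (cTgt a) ∉ ball (meshPoint E.δ v) ρ)) → (∀ i < n, medialPoint E.δ (cTgt (cornerOrbit (E.bcBondConfig ω) a i)) ∉ ball (meshPoint E.δ v) ρ ∧ E.IsInnerFace (cFace (cornerOrbit (E.bcBondConfig ω) a (i + 1)))) → medialPoint E.δ (cTgt (cornerOrbit (E.bcBondConfig ω) a n)) ∈ ball (meshPoint E.δ v) ρ → m < n → (∀ i < k, medialPoint E.δ (cTgt (cornerOrbit ((shiftData E w).bcBondConfig ω) a' i)) ∉ ball (meshPoint E.δ v) ρ ∧ (shiftData E w).IsInnerFace (cFace (cornerOrbit ((shiftData E w).bcBondConfig ω) a' (i + 1)))) → cornerOrbit ((shiftData E w).bcBondConfig ω) a' k = cornerOrbit (E.bcBondConfig ω) a m → ∑ i ∈ Finset.range k, turnOf ((shiftData E w).bcBondConfig ω) (cornerOrbit ((shiftData E w).bcBondConfig ω) a' i) = ∑ i ∈ Finset.range m, turnOf (E.bcBondConfig ω) (cornerOrbit (E.bcBondConfig ω) a i) → infDist (meshPoint E.δ (cornerOrbit (E.bcBondConfig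 ω) a m).1) D.carrierᶜ < 3 * η → ¬ (cTgt (cornerOrbit (E.bcBondConfig ω) a m) ∈ E.bcBondConfig ω ↔ cTgt (cornerOrbit (E.bcBondConfig ω) a m) ∈ (shiftData E w).bcBondConfig ω) → (∀ j j₀ : ℕ, m < j₀ → j₀ ≤ n → (∀ i < j, medialPoint E.δ (cTgt (cornerOrbit ((shiftData E w).bcBondConfig ω) (cornerOrbit (E.bcBondConfig ω) a m) i)) ∉ ball (meshPoint E.δ v) ρ ∧ (shiftData E w).IsInnerFace (cFace (cornerOrbit ((shiftData E w).bcBondConfig ω) (cornerOrbit (E.bcBondConfig ω) a m) (i + 1)))) → cornerOrbit ((shiftData E w).bcBondConfig ω) (cornerOrbit (E.bcBondConfig ω) a m) j = cornerOrbit (E.bcBondConfig ω) a j₀ → ∑ i ∈ Finset.range j, turnOf ((shiftData E w).bcBondConfig ω) (cornerOrbit ((shiftData E w).bcBondConfig ω) (cornerOrbit (E.bcBondConfig ω) a m) i) ≠ ∑ i ∈ Finset.Ico m j₀, turnOf (E.bcBondConfig ω) (cornerOrbit (E.bcBondConfig ω) a i)) → (∀ i < T, medialPoint E.δ (cTgt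 (cornerOrbit ((shiftData E w).bcBondConfig ω) (cornerOrbit (E.bcBondConfig ω) a m) i)) ∉ ball (meshPoint E.δ v) ρ ∧ (shiftData E w).IsInnerFace (cFace (cornerOrbit ((shiftData E w).bcBondConfig ω) (cornerOrbit (E.bcBondConfig ω) a m) (i + 1)))) → (medialPoint E.δ (cTgt (cornerOrbit ((shiftData E w).bcBondConfig ω) (cornerOrbit (E.bcBondConfig ω) a m) T)) ∈ ball (meshPoint E.δ v) ρ ∨ ¬ (shiftData E w).IsInnerFace (cFace (cornerOrbit ((shiftData E w).bcBondConfig ω) (cornerOrbit (E.bcBondConfig ω) a m) (T + 1)))) → ∃ z ∈ D.carrier, infDist z D.carrierᶜ < 3 * η ∧ ω ∈ ufrsCert E w z (4 * η) (ρ / 2) := by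
  intro hRS hDM D η hη
  obtain ⟨δ₁, hδ₁, hlast⟩ := ufrs_lastDeparture D η hη
  obtain ⟨δ₂, hδ₂, hrs⟩ := ufrsResidualSlippedReturn_iff.1 hRS D η hη
  obtain ⟨δ₃, hδ₃, hft⟩ := ufrs_freeTailCase_cert_of hDM D η hη
  obtain ⟨δ₄, hδ₄, hex⟩ := ufrs_exitCornerOnStretch_cert D η hη
  refine ⟨min (min δ₁ δ₂) (min δ₃ δ₄), lt_min (lt_min hδ₁ hδ₂) (lt_min hδ₃ hδ₄), ?_⟩
  intro E hEΩ hE hEδ v w ρ hηρ hv hw ω a a' n m k T hpair hStr hball hmn hStr₁ hek hsum hcolm hniff hmis hrun hend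
  have hδ₁' : E.δ < δ₁ := lt_of_lt_of_le hEδ ((min_le_left _ _).trans (min_le_left _ _))
  have hδ₂' : E.δ < δ₂ := lt_of_lt_of_le hEδ ((min_le_left _ _).trans (min_le_right _ _))
  have hδ₃' : E.δ < δ₃ := lt_of_lt_of_le hEδ ((min_le_right _ _).trans (min_le_left _ _))
  have hδ₄' : E.δ < δ₄ := lt_of_lt_of_le hEδ ((min_le_right _ _).trans (min_le_right _ _))
  obtain ⟨j, i, hjT, hin, hEq, -, hfree, -, -, hTcase⟩ :=
    hlast E hEΩ hE hδ₁' v w ρ hηρ hv hw ω a a' n m k T hpair hStr hball hmn.le hStr₁ hek hrun hend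
  rcases Nat.lt_or_ge j T with hjlt | hjge
  · -- nonempty free tail
    exact hft E hEΩ hE hδ₃' v w ρ hηρ hv hw ω a a' n m k T j i hpair hStr hball hmn hStr₁ hek hsum hcolm hniff hmis
      hrun hend hjlt hin hEq hfree
  · have hjE : j = T := le_antisymm hjT hjge
    rcases hTcase hjE with ⟨hballT, hieq⟩ | ⟨-, -, hA, hB, hIn, -, -, hcolζ⟩
    · -- slipped return: the run ends at the re-entry corner (residual sub-goal)
      refine hrs E hEΩ hE hδ₂' v w ρ hηρ hv hw ω a a' n m k T hpair hStr hball hmn hStr₁ hek hsum hcolm hniff hmis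
        hrun hend ?_ hballT
      rw [← hjE, hEq, hieq]
    · -- the run leaves the inner faces of the translate at its exit corner, on the stretch
      exact hex E hEΩ hE hδ₄' v w ρ hηρ hv hw ω a a' n i hpair hStr hball hin hA hB hIn hcolζ

end

end Summit.CriticalPhenomena.CardyFormulaZ2.Cruxes.EdgePrecompact.QkzStripBoundaryArm
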